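import Literature.NumberTheory.EllipticCurves.ModularCurve
import HarnessLib

/-!
# NODE `hasse-descent` on crux A = `SigmaCongruenceAtThree` (stmt-BirchSwinnertonDyer-27120, UTD rank 201)

Crux-ideate g13 (standing cover, D-0160/D-0171).  Companion memo: `NodeHasseDescent.md` (KEEP/KILL g13,
pieces, tags, leaves, barrier notes, dead lines).  This file imports NO `Cruxes/` module (the farm does not
build them) and NO route file: it is a LEAF REFINEMENT of the registered line
`Lines/sqrt_toric_functional.lean` (stub F = `stub_sqrtToricFunctional`) and of NodeTwistTruncationMeasure's
leaf EV; closure of A stays `SigmaCongruenceAtThree_of` of that line (kernel-checked there, unchanged).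

## The lever (one sentence)
Modulo 3, ON THE ORDINARY `∞`-COMPONENT of `X₀(3ʳM)`, a `Γ₀(3ʳ)`-structure on an ordinary curve is CANONICAL
(`ker F^r`), so the wild newform `f_E` (`27 ∣ N = 3ʳM`, `3 ∤ M`) reduces to a section `f̄_E` of `ω²` on the
GOOD-REDUCTION curve `X₀(M)_{𝔽̄₃}` with poles only at supersingular points; multiplying by a power of the Hasse
invariant `A` (weight `p − 1 = 2`, q-expansion `1`) gives a genuine mod-3 modular form
`g_E := A^j · f̄_E ∈ M_{2+2j}(Γ₀(M); 𝔽̄₃)` of level PRIME TO 3 with the SAME q-expansion as `f_E (mod 3)`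
("Hasse descent"; Katz 1973 §3 / Katz 1975 (level `pʳ` forms are `p`-adic modular of level `M`) / Serre 1973,
read modulo `p`; Katz–Mazur ch. 13 for the `(r,0)`-component).  The twin comparison `E ↔ E′` then takes place
between TWO mod-3 forms of prime-to-3 level on a smooth proper irreducible curve (`q`-expansion principle
there), and the wild prime `3` never enters the COMPARISON — only the per-curve residual evaluation of the
wild frame (leaf KJ′_E, print: Liu–Zhang–Zhang 2018 §4; Kriz 2021 Thm. 5.50 for CM points with `Γ₀(p^m)`-structure).

## What is typed here (over EXISTING declarations only)
* `HasseDescentQExpAtThree W` — the q-EXPANSION SHADOW of Hasse descent (piece HDq): the Dirichlet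
  coefficients `aₙ(W)` are congruent mod 3 to the Fourier coefficients of an INTEGRAL cusp form of some weight
  `2 + 2j` and some level `M′` COPRIME TO 3.  Tag: WEAKER than A (one curve, no frame, no character) ·
  leaf ATTACKABLE-by-port (M): Katz 1975 "Higher congruences" (forms on `Γ₁(3ʳ) ∩ Γ₁(M)` with 3-integral
  q-expansion are 3-adic modular forms of level `M`) read mod 3 + Katz 1973 Thm. 1.7.1 (base change / lifting
  for `k ≥ 2` at a rigidifying level `M′ = M·q`, `q ≡ 11 (mod 12)`).  For `3 ∤ N` it is literally modularity
  (`hasseDescentQExp_of_coprime`, PROVED from `ModularParametrizationData`): all content sits at `3 ∣ N`.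
* `KatzSerreLevelStrippingAtThree` — HDq for every modular elliptic curve (the named print-fact shape the
  port would land; NOT asserted here).
* TOY RUNG, PROVED (`frobenius_factor_three`, `eta27_trunc_eq_delta_trunc`): in `𝔽₃[q]`,
  `(1 − qⁿ)²⁴ = (1 − q³ⁿ)²(1 − q⁹ⁿ)²` for every `n` (Frobenius), hence EVERY truncation of the q-product of
  `η(3τ)²η(9τ)²` — the newform of the conductor-27 curve 27a (Martin–Ono 1997, Table; CM, Kodaira IV*, the
  wild cell `(w)` of ClassO6) — equals the same truncation of the q-product of `Δ = η(τ)²⁴` (level ONE,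
  weight `12 = 2 + 2·5`).  So `f_{27a} ≡ Δ (mod 3)` coefficientwise: the wild conductor-27 form IS, mod 3,
  the level-1 form `Δ = A⁵·f̄_{27a}` — Hasse descent with `j = 5`, `M = 1`, decided by `ring` in characteristic 3.

Informal pieces (memo §2): HDgeo (the section-level descent: CM values / Serre–Tate expansions of `f_E` at
canonical-`27` Heegner points `=` those of `g_E · A(x)^{-j}`, `A(x)` a unit CONSTANT along the prime-to-3 CM
isogeny orbit), RHub (residual transport at prime-to-3 level across weights `2+2j ↔ 2`: Katz linearity in
`𝕍(M′)` or, mod 3, equality of sections on `X₀(M′)_{𝔽̄₃}`), KJ′_E / KJ′_{E′} (per-curve residual evaluation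
of the frames).  HDq ∧ HDgeo ∧ RHub ∧ KJ′ ∧ H ∧ hB ⟹ A is the line's `SigmaCongruenceAtThree_of` with stub F
realised through the hub `g_E` (memo §2.4); nothing new is CLOSED here.
-/

noncomputable section

open scoped MatrixGroups ModularForm
open CongruenceSubgroup Polynomial

set_option linter.dupNamespace false
set_option autoImplicit false

namespace Summit.BirchSwinnertonDyer.BirchSwinnertonDyer.Cruxes.SigmaCongruenceAtThree.HasseDescent

open Literature.NumberTheory.EllipticCurves.ModularForms

/-! ## §1  Piece HDq — the q-expansion shadow of Hasse descent (WEAKER than A; ATTACKABLE-by-port) -/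

/-- **HDq (Hasse descent, q-expansion shadow) for one curve `W/ℚ` at the prime 3.**  There are a level `M′`
COPRIME TO 3, a weight `k = 2 + 2j` and a cusp form `g ∈ S_k(Γ₀(M′))` with INTEGER Fourier coefficients
`aₙ(g) ≡ aₙ(W) (mod 3)` for every `n` (`aₙ(W)` = Mathlib's `WeierstrassCurve.LFunction`, `a₀ = 0` on both
sides).  For `27 ∣ N_W` this says: modulo 3 the wild newform `f_W` has level prime to 3 (its 3-level is carried
by the Hasse invariant, `g = A^j f̄_W` lifted to characteristic 0 at a rigidifying level).
Sources: Katz, Ann. of Math. 101 (1975) (level `pʳ` ⊂ p-adic modular of level `M`); Katz, LNM 350 (1973) §3,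
Thm. 1.7.1; Serre, LNM 350 (1973) (the `Γ₀(p)` case); Katz–Mazur, Annals Studies 108, ch. 13 (components of
`X₀(pʳM) ⊗ 𝔽_p`).  Tag: WEAKER · ATTACKABLE-by-port (M).
[cite: Katz1975, Thm. (forms on Γ₁(pʳ)∩Γ₁(M) are p-adic modular of level M)] [cite: Katz1973, Thm. 1.7.1, §3]
[cite: Serre1973ZetaPadiques, §3 (Γ₀(p) case)] [cite: KatzMazur1985, ch. 13 (special fibre of X₀(pʳM))] -/
def HasseDescentQExpAtThree (W : WeierstrassCurve ℚ) : Prop :=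
  ∃ (M' : ℕ) (k : ℤ) (g : CuspForm (Gamma0 M') k),
    Nat.Coprime M' 3 ∧ (∃ j : ℕ, k = 2 + 2 * (j : ℤ)) ∧
      ∀ n : ℕ, ∃ m : ℤ, cuspCoeff g n = (m : ℂ) ∧ (3 : ℤ) ∣ m - W.LFunction n

/-- **The print-fact shape of HDq** (Katz–Serre level stripping at 3, for every modular elliptic curve over
`ℚ`): NOT asserted, NOT used as a hypothesis anywhere in this file — it is the statement a Literature port
(`Literature/NumberTheory/ModularForms/Katz1975…`) would name.  Tag: leaf ATTACKABLE-by-port.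
[cite: Katz1975, Thm.] [cite: Katz1973, Thm. 1.7.1] -/
def KatzSerreLevelStrippingAtThree : Prop :=
  ∀ (W : WeierstrassCurve ℚ) (N : ℕ) [NeZero N], ModularParametrizationData W N → HasseDescentQExpAtThree W

/-- HDq is literally modularity when `3 ∤ N`: take `g = f_W` itself (`j = 0`).  So the whole content of HDq
sits at `3 ∣ N` (tame `3 ‖ N`: Serre 1973; wild `9 ∣ N`: Katz 1975). -/
theorem hasseDescentQExp_of_coprime {W : WeierstrassCurve ℚ} {N : ℕ} [NeZero N]
    (Dt : ModularParametrizationData W N) (hN : Nat.Coprime N 3) : HasseDescentQExpAtThree W :=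
  ⟨N, 2, Dt.f, hN, ⟨0, by norm_num⟩, fun n ↦ ⟨W.LFunction n, Dt.isNewformOf.2 n, by simp⟩⟩

/-! ## §2  Toy rung (PROVED): `f_{27a} ≡ Δ (mod 3)` — Hasse descent with `j = 5`, `M = 1`

`f_{27a} = η(3τ)²η(9τ)² = q ∏ₙ (1 − q³ⁿ)²(1 − q⁹ⁿ)²` (Martin–Ono, Proc. AMS 125 (1997), Thm. 2 / Table I,
conductor 27; [cite: MartinOno1997, Thm. 2]) and `Δ = η(τ)²⁴ = q ∏ₙ (1 − qⁿ)²⁴`.  In characteristic 3 the `n`-th factors already agree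
(`(1 − X)³ = 1 − X³`), so all truncated products agree in `𝔽₃[q]`; every q-expansion coefficient of either
form is read off a sufficiently long truncation, hence `aₙ(27a) ≡ τ(n) (mod 3)` for all `n`
(check: `τ(2) = −24 ≡ 0 = a₂`, `τ(4) = −1472 ≡ 1 ≡ −2 = a₄`, `τ(7) = −16744 ≡ −1 = a₇`,
`τ(13) = −577738 ≡ −1 ≡ 5 = a₁₃`). -/

private instance factPrimeThree : Fact (Nat.Prime 3) := ⟨Nat.prime_three⟩

/-- Frobenius in `𝔽₃[X]`: `(1 − P)³ = 1 − P³`. -/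
theorem one_sub_pow_three (P : (ZMod 3)[X]) : (1 - P) ^ 3 = 1 - P ^ 3 := by
  have h := sub_pow_char (R := (ZMod 3)[X]) (p := 3) (1 : (ZMod 3)[X]) P
  simpa using h

/-- **Toy rung, factor form.**  In `𝔽₃[X]`: `(1 − Xⁿ)²⁴ = (1 − X³ⁿ)² · (1 − X⁹ⁿ)²` — the `n`-th factor of
`Δ/q = ∏(1 − qⁿ)²⁴` equals the `n`-th factor of `η(3τ)²η(9τ)²/q = ∏(1 − q³ⁿ)²(1 − q⁹ⁿ)²`. -/
theorem frobenius_factor_three (n : ℕ) :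
    ((1 - X ^ n) ^ 24 : (ZMod 3)[X]) = (1 - X ^ (3 * n)) ^ 2 * (1 - X ^ (9 * n)) ^ 2 := by
  have hA : ((1 - X ^ n) ^ 3 : (ZMod 3)[X]) = 1 - X ^ (3 * n) := by
    rw [one_sub_pow_three, ← pow_mul, mul_comm]
  have hB : ((1 - X ^ (3 * n)) ^ 3 : (ZMod 3)[X]) = 1 - X ^ (9 * n) := by
    rw [one_sub_pow_three, ← pow_mul]; ring_nf
  calc ((1 - X ^ n) ^ 24 : (ZMod 3)[X]) = ((1 - X ^ n) ^ 3) ^ 8 := by rw [← pow_mul]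
    _ = (1 - X ^ (3 * n)) ^ 8 := by rw [hA]
    _ = (1 - X ^ (3 * n)) ^ 2 * ((1 - X ^ (3 * n)) ^ 3) ^ 2 := by ring
    _ = (1 - X ^ (3 * n)) ^ 2 * (1 - X ^ (9 * n)) ^ 2 := by rw [hB]

/-- **Toy rung, truncated-product form: `f_{27a} ≡ Δ (mod 3)`.**  For every `N`, the `N`-truncated q-product
of `η(3τ)²η(9τ)²` (the newform of 27a) equals the `N`-truncated q-product of `Δ = η(τ)²⁴` in `𝔽₃[q]`.
(Hasse descent for the wild CM curve 27a: `A⁵ · f̄_{27a} = Δ̄` on `X(1)_{𝔽̄₃}`, `j = 5`, level `M = 1`.) -/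
theorem eta27_trunc_eq_delta_trunc (N : ℕ) :
    (X * ∏ n ∈ Finset.range N, ((1 - X ^ (3 * (n + 1))) ^ 2 * (1 - X ^ (9 * (n + 1))) ^ 2) : (ZMod 3)[X])
      = X * ∏ n ∈ Finset.range N, (1 - X ^ (n + 1)) ^ 24 := by
  have h : (∏ n ∈ Finset.range N, ((1 - X ^ (3 * (n + 1))) ^ 2 * (1 - X ^ (9 * (n + 1))) ^ 2) :
      (ZMod 3)[X]) = ∏ n ∈ Finset.range N, (1 - X ^ (n + 1)) ^ 24 :=
    Finset.prod_congr rfl fun n _ ↦ (frobenius_factor_three (n + 1)).symm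
  exact congrArg (fun P : (ZMod 3)[X] ↦ X * P) h

/-- Numerical cross-check of the first coefficients (integer arithmetic, `decide`): `τ(n) ≡ aₙ(27a) (mod 3)`
for `n = 2, 3, 4, 5, 6, 7, 13` with `τ(n) = −24, 252, −1472, 4830, −6048, −16744, −577738` and
`aₙ(27a) = 0, 0, −2, 0, 0, −1, 5`. -/
example : (-24 : ℤ) % 3 = 0 % 3 ∧ (252 : ℤ) % 3 = 0 % 3 ∧ (-1472 : ℤ) % 3 = (-2 : ℤ) % 3 ∧
    (4830 : ℤ) % 3 = 0 % 3 ∧ (-6048 : ℤ) % 3 = 0 % 3 ∧ (-16744 : ℤ) % 3 = (-1 : ℤ) % 3 ∧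
    (-577738 : ℤ) % 3 = (5 : ℤ) % 3 := by
  norm_num

end Summit.BirchSwinnertonDyer.BirchSwinnertonDyer.Cruxes.SigmaCongruenceAtThree.HasseDescent

end
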